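import Literature.NumberTheory.Transcendental.NesterenkoElimination
import HarnessLib

/-!
# Dehomogenising block-homogeneous polynomials (towards LNM 1752 Ch. 3 Prop. 4.7 2), 3))

Topic `Literature/NumberTheory/Transcendental`. Nesterenko's associated forms `F ∈ ℚ[u₁, …, u_r]`
(LNM 1752 Ch. 3 §4) are homogeneous in each block of variables `uᵢ = (u_{i0}, …, u_{im})`, and so
are their images `ϰ(F)` in the blocks of skew variables `s⁽ⁱ⁾`. Gelfond's lemma
(`Literature/NumberTheory/DiophantineGeometry/GelfondLemma.lean`) charges one unit per variable and
per unit of degree, so to reach the printed constants `m² deg I`, `m³ deg I` of Proposition 4.7 one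
first sets ONE variable per block equal to `1`: for block-homogeneous polynomials this changes
neither the set of coefficients (hence neither `|F|` nor `h(F)`) nor products, and it bounds every
remaining partial degree by the block degree. This file provides that bookkeeping for polynomials in
variables `Fin r × α` (blocks indexed by `Fin r`) over any commutative semiring:

* `dehomIdx a₀`, `dehom a₀` — dropping the exponents of / substituting `1` for the variables `(i, a₀)`;
* `dehom_monomial`, `dehom_eq_sum`, `injOn_dehomIdx` (block-homogeneity ⇒ injective on the
  support), `coeff_dehom`, `support_dehom`, `dehom_ne_zero`, `card_support_dehom`,
  `degreeOf_dehom_le`;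
* `maxNorm_dehom` (normed field of coefficients) and `height_dehom` (`ℚ`): `|F|` and `h(F)` are
  unchanged.

Everything is proved; folklore bookkeeping, nothing is cited beyond the definitions it serves.

## References

* [NesterenkoPhilippon2001] LNM 1752 (2001), Ch. 3 §4, Def. 4.1, 4.2, 4.5, 4.6, Prop. 4.7 (pp. 37–39).
-/

noncomputable section

open MvPolynomial

namespace Literature.NumberTheory.Transcendental

namespace Nesterenko

section General

variable {K : Type*} [CommSemiring K] {r : ℕ} {α : Type*}

/-- Dropping the exponents of the distinguished variables `(i, a₀)` from an exponent vector.
[folklore] -/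
def dehomIdx (a₀ : α) (e : Fin r × α →₀ ℕ) : Fin r × {a : α // a ≠ a₀} →₀ ℕ :=
  e.comapDomain (fun v : Fin r × {a : α // a ≠ a₀} => ((v.1, v.2.1) : Fin r × α))
    (fun v _ w _ h => by
      simp only [Prod.mk.injEq] at h
      exact Prod.ext h.1 (Subtype.ext h.2))

/-- `dehomIdx` reads off the exponents of the remaining variables. [folklore] -/
@[simp] theorem dehomIdx_apply (a₀ : α) (e : Fin r × α →₀ ℕ) (i : Fin r) (a : {a : α // a ≠ a₀}) :
    dehomIdx a₀ e (i, a) = e (i, a.1) :=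
  Finsupp.comapDomain_apply _ _ _ _

variable [DecidableEq α]

variable (K) in
/-- **Dehomogenisation**: the algebra map substituting `1` for every distinguished variable
`(i, a₀)` and keeping the others. [folklore] -/
def dehom (a₀ : α) : MvPolynomial (Fin r × α) K →ₐ[K] MvPolynomial (Fin r × {a : α // a ≠ a₀}) K :=
  aeval fun v : Fin r × α => if h : v.2 = a₀ then 1 else X (v.1, ⟨v.2, h⟩)

variable [Fintype α]

/-- `dehom` on monomials: drop the distinguished exponents. [folklore] -/
theorem dehom_monomial (a₀ : α) (e : Fin r × α →₀ ℕ) (c : K) :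
    dehom K a₀ (monomial e c) = monomial (dehomIdx a₀ e) c := by
  rw [dehom, aeval_monomial, monomial_eq, MvPolynomial.algebraMap_eq]
  congr 1
  rw [Finsupp.prod_fintype _ _ (fun v => by simp), Finsupp.prod_fintype _ _ (fun v => by simp),
    Fintype.prod_prod_type, Fintype.prod_prod_type]
  refine Finset.prod_congr rfl fun i _ => ?_
  rw [← Fintype.prod_subtype_mul_prod_subtype (fun a : α => a ≠ a₀)
    (fun a : α => (if h : a = a₀ then (1 : MvPolynomial (Fin r × {a : α // a ≠ a₀}) K)
      else X (i, ⟨a, h⟩)) ^ e (i, a))]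
  have h2 : ∏ a : {a : α // ¬a ≠ a₀},
      (if h : (a : α) = a₀ then (1 : MvPolynomial (Fin r × {a : α // a ≠ a₀}) K)
        else X (i, ⟨a, h⟩)) ^ e (i, a) = 1 :=
    Finset.prod_eq_one fun a _ => by rw [dif_pos (not_not.mp a.2), one_pow]
  rw [h2, mul_one]
  refine Finset.prod_congr rfl fun a _ => ?_
  rw [dif_neg a.2, dehomIdx_apply]

/-- `dehom F = ∑_e coeff_e · (monomial without the distinguished exponents)`. [folklore] -/
theorem dehom_eq_sum (a₀ : α) (F : MvPolynomial (Fin r × α) K) :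
    dehom K a₀ F = ∑ e ∈ F.support, monomial (dehomIdx a₀ e) (coeff e F) := by
  conv_lhs => rw [F.as_sum, map_sum]
  simp only [dehom_monomial]

/-- **Block-homogeneity makes dehomogenisation lossless**: on a set of exponents all of which have
the same degree `D i` in each block `i`, `dehomIdx` is injective (the dropped exponent is
`D i` minus the others). [folklore] -/
theorem injOn_dehomIdx (a₀ : α) {S : Set (Fin r × α →₀ ℕ)} {D : Fin r → ℕ}
    (hS : ∀ e ∈ S, ∀ i, ∑ a, e (i, a) = D i) : Set.InjOn (dehomIdx (r := r) a₀) S := by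
  intro e he e' he' h
  ext ⟨i, a⟩
  have hne : ∀ b : α, b ≠ a₀ → e (i, b) = e' (i, b) := fun b hb => by
    have := congrArg (fun f => f (i, ⟨b, hb⟩)) h
    simpa using this
  by_cases ha : a = a₀
  · subst ha
    have h1 := hS e he i
    have h2 := hS e' he' i
    rw [← Finset.add_sum_erase _ _ (Finset.mem_univ a)] at h1 h2
    have h3 : ∑ b ∈ Finset.univ.erase a, e (i, b) = ∑ b ∈ Finset.univ.erase a, e' (i, b) :=
      Finset.sum_congr rfl fun b hb => hne b (Finset.ne_of_mem_erase hb)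
    omega
  · exact hne a ha

/-- Coefficients are preserved by a lossless dehomogenisation. [folklore] -/
theorem coeff_dehom (a₀ : α) (F : MvPolynomial (Fin r × α) K)
    (hinj : Set.InjOn (dehomIdx (r := r) a₀) F.support) {e : Fin r × α →₀ ℕ} (he : e ∈ F.support) :
    coeff (dehomIdx a₀ e) (dehom K a₀ F) = coeff e F := by
  classical
  rw [dehom_eq_sum, coeff_sum]
  simp_rw [coeff_monomial]
  rw [Finset.sum_eq_single e (fun e' he' hne => if_neg fun h => hne (hinj he' he h))
    (fun h => absurd he h), if_pos rfl]

/-- The support of a lossless dehomogenisation is the image of the support. [folklore] -/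
theorem support_dehom (a₀ : α) (F : MvPolynomial (Fin r × α) K)
    (hinj : Set.InjOn (dehomIdx (r := r) a₀) F.support) :
    (dehom K a₀ F).support = F.support.image (dehomIdx a₀) := by
  classical
  ext d
  constructor
  · intro hd
    rw [mem_support_iff, dehom_eq_sum, coeff_sum] at hd
    obtain ⟨e, he, hne⟩ := Finset.exists_ne_zero_of_sum_ne_zero hd
    rw [coeff_monomial] at hne
    split_ifs at hne with h
    · exact Finset.mem_image.mpr ⟨e, he, h⟩
    · exact absurd rfl hne
  · intro hd
    obtain ⟨e, he, rfl⟩ := Finset.mem_image.mp hd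
    rw [mem_support_iff, coeff_dehom a₀ F hinj he]
    exact mem_support_iff.mp he

/-- A lossless dehomogenisation has as many monomials. [folklore] -/
theorem card_support_dehom (a₀ : α) (F : MvPolynomial (Fin r × α) K)
    (hinj : Set.InjOn (dehomIdx (r := r) a₀) F.support) :
    (dehom K a₀ F).support.card = F.support.card := by
  classical
  rw [support_dehom a₀ F hinj, Finset.card_image_of_injOn hinj]

/-- A lossless dehomogenisation of a non-zero polynomial is non-zero. [folklore] -/
theorem dehom_ne_zero (a₀ : α) {F : MvPolynomial (Fin r × α) K}
    (hinj : Set.InjOn (dehomIdx (r := r) a₀) F.support) (hF : F ≠ 0) : dehom K a₀ F ≠ 0 := by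
  classical
  intro h
  have hc := card_support_dehom a₀ F hinj
  rw [h, support_zero, Finset.card_empty] at hc
  exact hF (support_eq_empty.mp (Finset.card_eq_zero.mp hc.symm))

/-- After dehomogenisation every remaining partial degree is at most the block degree.
[folklore] -/
theorem degreeOf_dehom_le (a₀ : α) (F : MvPolynomial (Fin r × α) K) {D : Fin r → ℕ}
    (hF : ∀ e ∈ F.support, ∀ i, ∑ a, e (i, a) = D i) (i : Fin r) (a : {a : α // a ≠ a₀}) :
    degreeOf (i, a) (dehom K a₀ F) ≤ D i := by
  classical
  rw [degreeOf_le_iff]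
  intro d hd
  have hinj : Set.InjOn (dehomIdx (r := r) a₀) F.support :=
    injOn_dehomIdx a₀ (S := (F.support : Set _)) (D := D) fun e he i => hF e he i
  rw [support_dehom a₀ F hinj, Finset.mem_image] at hd
  obtain ⟨e, he, rfl⟩ := hd
  rw [dehomIdx_apply, ← hF e he i]
  exact Finset.single_le_sum (f := fun b => e (i, b)) (fun _ _ => Nat.zero_le _) (Finset.mem_univ _)

end General

/-! ### The coefficient norms are unchanged -/

section Norms

variable {r : ℕ} {α : Type*} [DecidableEq α] [Fintype α]

/-- `|dehom F| = |F|` (same set of coefficients). [folklore] -/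
theorem maxNorm_dehom {K : Type*} [NormedField K] (a₀ : α) (F : MvPolynomial (Fin r × α) K)
    (hinj : Set.InjOn (dehomIdx (r := r) a₀) F.support) :
    maxNorm (dehom K a₀ F) = maxNorm F := by
  classical
  unfold maxNorm
  rw [support_dehom a₀ F hinj, Finset.sup_image]
  congr 1
  refine Finset.sup_congr rfl fun e he => ?_
  simp only [Function.comp_apply]
  rw [coeff_dehom a₀ F hinj he]

/-- `h(dehom F) = h(F)` over `ℚ` (same family of coefficients up to reindexing).
[folklore] -/
theorem height_dehom (a₀ : α) (F : MvPolynomial (Fin r × α) ℚ)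
    (hinj : Set.InjOn (dehomIdx (r := r) a₀) F.support) :
    height (dehom ℚ a₀ F) = height F := by
  classical
  have hsupp := support_dehom a₀ F hinj
  have hmem : ∀ x : F.support, dehomIdx a₀ x.1 ∈ (dehom ℚ a₀ F).support := fun x => by
    rw [hsupp]
    exact Finset.mem_image_of_mem _ x.2
  let g : F.support → (dehom ℚ a₀ F).support := fun x => ⟨dehomIdx a₀ x.1, hmem x⟩
  have hg : Function.Bijective g := by
    constructor
    · intro x y h
      exact Subtype.ext (hinj x.2 y.2 (congrArg Subtype.val h))
    · intro y
      have hy : (y : Fin r × {a : α // a ≠ a₀} →₀ ℕ) ∈ F.support.image (dehomIdx a₀) := by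
        rw [← hsupp]
        exact y.2
      obtain ⟨e, he, hey⟩ := Finset.mem_image.mp hy
      exact ⟨⟨e, he⟩, Subtype.ext hey⟩
  let eqv : F.support ≃ (dehom ℚ a₀ F).support := Equiv.ofBijective g hg
  have hfun : (fun γ : F.support => F.coeff γ) =
      (fun γ : (dehom ℚ a₀ F).support => (dehom ℚ a₀ F).coeff γ) ∘ eqv := by
    funext γ
    simp only [Function.comp_apply, eqv, Equiv.ofBijective_apply, g]
    exact (coeff_dehom a₀ F hinj γ.2).symm
  rw [height, height, hfun, Height.logHeight_comp_equiv]

end Norms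

end Nesterenko

end Literature.NumberTheory.Transcendental

end
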